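import Summits.AtomisticToContinuum.BoseEinsteinCondensation.Theses.BECCutLineWeakDisorder
import Summits.AtomisticToContinuum.BoseEinsteinCondensation.Theorems.BECCutLineWeakDisorderDefs
import Literature.MathematicalPhysics.QuantumManyBody.GroundStateFeynmanKacPositivity
import HarnessLib

/-!
# Disproof of `TwoReplicaTransienceBound` (stmt-AtomisticToContinuum-9687) — findings

Work file of the crux disprover (refuter-cdisprove-stmt-AtomisticToContinuum-9687-0, cycle 1,
2026-08-16). Sorries ONLY in section `NearMisses` (documented there). Index:

1. **Crux: no kill; it resists for structural reasons** (audit of the `def`, symbol by symbol):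
   * every junk/degenerate regime evaluates the integral to `0 ≤ C`, i.e. makes the crux TRUE,
     never false: `‖e^{-TH}1‖₂² ∈ {0,∞}` ⇒ `fkWitness ≡ 0`; a slice with `s(Y) = 0` has `m(Y) = 0`
     and `0/0 = 0`; `s(Y), m(Y) < ∞` always (`Ψ_T ≤ 1/√𝒩`, supported in the box); `ρ = 0` ⇒
     `L = 0` ⇒ empty box; `v` is measurable by definition of `IsRepulsiveFiniteRange`;
   * `1 ≤ T` is not load-bearing (`T = 0` gives the flat witness, ratio `= 1`; `T < 0` is junk
     `= T = 0`); `∀ᶠ n` vs `∀ n` is not load-bearing (`n = 0`: one free particle, ratio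
     `∈ [1,(π²/8)³]`); `ρ < ρ₀(v)` IS load-bearing physically (hard spheres crystallise at high
     density: `R ~ L³/cell ~ N`) but no rigorous crystallisation exists — not refutable;
   * physics of the intended regime: `E_Q[R]` bounded uniformly in `N` for the dilute 3-D gas is
     open but robust — Lifshitz voids of radius `r` gain `e^{2r²/ξ²}` at probability
     `~e^{-c(r/ℓ)⁴}` (summable); the `1/r²` zero-point-phonon Jastrow tail gives a CONVERGENT
     endpoint-potential fluctuation in `d = 3` (`∫(r⁻²)² r² dr < ∞`); no diverging lower bound is
     known for any admissible `v` at low density. A refutation would be harder than BEC itself.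
2. **LANDED negative content** (sorry-free; in the tree as
   `Theorems/TwoReplicaTransienceBound/Negative/ConstantAtLeastOne.lean`, proposal p98835,
   commit 46c82cbfd7c6 — import `…Theorems.TwoReplicaTransienceBound.Negative.ConstantAtLeastOne`,
   names `one_le_lintegral_ratio`, `fkNormSq_one_ne_zero`, `fkNormSq_one_ne_top`,
   `one_le_lintegral_ratio_fkWitness`, `not_twoReplicaTransienceBound_below_one`; the copies below
   keep this work file self-contained): `R_L(f) ≥ 1` for every normalised bounded Dirichlet `f`
   (the constant lives in `[1,∞)`); non-degenerate witness `0 < ‖e^{-TH}1‖₂² < ∞` for BOUNDED `v`,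
   `L, T > 0` (the crux is not vacuous-by-degeneracy there); the strengthening `C < 1` is FALSE
   (free gas, `T = 1`). Sharp constant conjecturally `(π²/8)³ ≈ 1.878` (free Dirichlet gas,
   `T → ∞`; not formalised).
3. **Line `SketchIdeator1` (picked): the ENGINE stub `stub_tracerSecondMoment` is FALSE as
   stated** (section `Line`): at fixed `n` the annealed two-tracer moment outgrows `‖Z_T‖₂²` like
   `e^{γₙT}`, `γₙ = 2E_{n+1} − E_n − E'_{n+2} > 0` (bath-mediated attraction of two tracer
   replicas sharing ONE bath history; in a finite box two tracers are recurrent, `γₙ ∝ 1/L³`).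
   Kernel-checked bookkeeping: `tracerSecondMoment_false_of_fixedBoxTracerDivergence`. Toy exact
   diagonalisation (jobs `j016489`, `j016586`): `γ > 0` in every interacting case (d = 1, n = 1, 2;
   d = 3 lattice n = 1), `γ = 0` and engine ≡ crux in every free case; e.g. d = 1, n = 1,
   `v = 5·𝟙_{[0,1)}`, `L = 10`: crux saturates at `1.656` for `T ≥ 11` while
   engine/‖Z‖² `= 1.382·e^{0.1501 T}` (`3.5·10¹³⁰` at `T = 2000`). Stubs `stub_factorisation`,
   `stub_tracerMeasurable`, `stub_decoupling` are TRUE (pairs `i<j` match `vecCons`; Tonelli;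
   Cauchy–Schwarz) — the loss is entirely in using the decoupling for ALL `T`.
   REPAIR (lead, no planner needed — the crux is unchanged): restrict the engine to a window
   `1 ≤ T ≤ Tmax n` with `N^{1/3+ε} ≲ Tmax n ≪ N` (e.g. `Tmax n = L² = ((n+1)/ρ)^{2/3}`, the
   diffusive time: all phonon modes relaxed, `γₙ Tmax → 0`), where the single-bath two-tracer
   moment is governed by TRANSIENCE (Bolthausen's `L²` region proper), and add a late-time
   stability stub `∀ T ≥ Tmax n, R_T ≤ R_{Tmax n} + 1` (fixed-`N` spectral gap; the crux's own
   `R_T` converges). Keeping past/future tracers in independent baths instead reproduces the crux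
   verbatim (costume).
-/

noncomputable section

namespace Summit.AtomisticToContinuum.BoseEinsteinCondensation.Cruxes.TwoReplicaTransienceBound.Disproof

open MeasureTheory Filter Set
open scoped ENNReal NNReal Topology BigOperators
open Literature.MathematicalPhysics.QuantumManyBody.BoseGas
open Summit.AtomisticToContinuum.BoseEinsteinCondensation.Theorems.CutLineWitness

variable {n : ℕ}

/-! ### The cut-line second-moment functional and its floor `1` -/

/-- The crux's functional `R_L(f) = ∫ L³ m(Y)² / s(Y)² dY`, `m(Y) = ∫ |f(x::Y)|² dx`,
`s(Y) = ∫ |f(x::Y)| dx` (`[0,∞]`-valued, `x/0`, `x/∞` conventions of `ENNReal`). -/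
def cutMoment (n : ℕ) (L : ℝ) (f : Config (n + 1) → ℝ) : ℝ≥0∞ :=
  ∫⁻ Y : Config n, ENNReal.ofReal (L ^ 3) *
    (∫⁻ x, (‖f (Matrix.vecCons x Y)‖₊ : ℝ≥0∞) ^ 2) ^ 2 /
      (∫⁻ x, (‖f (Matrix.vecCons x Y)‖₊ : ℝ≥0∞)) ^ 2

/-- Fubini over the first particle: `∫ F(X) dX = ∫ dY ∫ dx F(x :: Y)`. -/
theorem lintegral_eq_lintegral_vecCons {F : Config (n + 1) → ℝ≥0∞} (hF : Measurable F) :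
    ∫⁻ X, F X = ∫⁻ Y : Config n, ∫⁻ x : Space, F (Matrix.vecCons x Y) := by
  have he : ∀ p : Space × Config n, (MeasurableEquiv.piFinSuccAbove (fun _ : Fin (n + 1) =>
      Space) 0).symm p = Matrix.vecCons p.1 p.2 := fun p => Fin.insertNth_zero' p.1 p.2
  refine ((measurePreserving_piFinSuccAbove (fun _ : Fin (n + 1) => (volume : Measure Space))
    0).symm.lintegral_comp_emb (MeasurableEquiv.measurableEmbedding _) F).symm.trans ?_
  simp only [he]
  exact lintegral_prod_symm _ (hF.comp measurable_vecCons).aemeasurable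

/-- **Slice Cauchy–Schwarz**: for a slice supported in `Λ_L` with finite mass,
`m(Y) ≤ L³ m(Y)²/s(Y)²` (i.e. `s² ≤ |Λ| m`). -/
theorem slice_le_ratio {L : ℝ} (hL : 0 ≤ L) {g : Space → ℝ} (hg : Measurable g)
    (hsupp : ∀ x, x ∉ box L → g x = 0) (hfin : ∫⁻ x, (‖g x‖₊ : ℝ≥0∞) ≠ ⊤) :
    ∫⁻ x, (‖g x‖₊ : ℝ≥0∞) ^ 2 ≤
      ENNReal.ofReal (L ^ 3) * (∫⁻ x, (‖g x‖₊ : ℝ≥0∞) ^ 2) ^ 2 / (∫⁻ x, (‖g x‖₊ : ℝ≥0∞)) ^ 2 := by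
  set m := ∫⁻ x, (‖g x‖₊ : ℝ≥0∞) ^ 2 with hm
  set s := ∫⁻ x, (‖g x‖₊ : ℝ≥0∞) with hs
  have hgm : Measurable fun x => (‖g x‖₊ : ℝ≥0∞) := hg.nnnorm.coe_nnreal_ennreal
  -- Cauchy–Schwarz against the indicator of the box: `s² ≤ |Λ_L| m`
  have hcs : s ^ 2 ≤ ENNReal.ofReal (L ^ 3) * m := by
    have hind : ∀ x, (‖g x‖₊ : ℝ≥0∞) = (box L).indicator (fun _ => (1 : ℝ≥0∞)) x * ‖g x‖₊ := by
      intro x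
      by_cases hx : x ∈ box L
      · simp [Set.indicator_of_mem hx]
      · simp [Set.indicator_of_notMem hx, hsupp x hx]
    have h1 := ENNReal.lintegral_mul_le_Lp_mul_Lq volume Real.HolderConjugate.two_two
      (f := (box L).indicator fun _ => (1 : ℝ≥0∞)) (g := fun x => (‖g x‖₊ : ℝ≥0∞))
      ((measurable_const.indicator (measurableSet_box L)).aemeasurable) hgm.aemeasurable
    have hI : ∫⁻ x, (box L).indicator (fun _ => (1 : ℝ≥0∞)) x ^ (2 : ℝ) = ENNReal.ofReal (L ^ 3) := by
      have : ∀ x, (box L).indicator (fun _ => (1 : ℝ≥0∞)) x ^ (2 : ℝ) =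
          (box L).indicator (fun _ => (1 : ℝ≥0∞)) x := fun x => by
        by_cases hx : x ∈ box L <;> simp [hx]
      simp_rw [this]
      rw [lintegral_indicator (measurableSet_box L), setLIntegral_const, one_mul, volume_box,
        ENNReal.ofReal_pow hL]
    calc s ^ 2 = (∫⁻ x, (box L).indicator (fun _ => (1 : ℝ≥0∞)) x * ‖g x‖₊) ^ 2 := by
          rw [hs]; congr 1; exact lintegral_congr fun x => hind x
      _ ≤ ((∫⁻ x, (box L).indicator (fun _ => (1 : ℝ≥0∞)) x ^ (2 : ℝ)) ^ (1 / (2 : ℝ)) *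
            (∫⁻ x, (‖g x‖₊ : ℝ≥0∞) ^ (2 : ℝ)) ^ (1 / (2 : ℝ))) ^ 2 := by
          gcongr; simpa only [Pi.mul_apply] using h1
      _ = ENNReal.ofReal (L ^ 3) * m := by
          rw [hI, mul_pow, ← ENNReal.rpow_two, ← ENNReal.rpow_two, ← ENNReal.rpow_mul,
            ← ENNReal.rpow_mul, hm]
          norm_num
  rcases eq_or_ne s 0 with h0 | h0
  · -- `s = 0`: the slice vanishes a.e., so `m = 0`
    have hae : (fun x => (‖g x‖₊ : ℝ≥0∞)) =ᵐ[volume] 0 := (lintegral_eq_zero_iff hgm).1 h0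
    have hm0 : m = 0 := by
      rw [hm, lintegral_eq_zero_iff (hgm.pow_const 2)]
      filter_upwards [hae] with x hx
      simp [hx]
    rw [hm0]; exact bot_le
  have h2 : s ^ 2 ≠ 0 := pow_ne_zero _ h0
  have h2t : s ^ 2 ≠ ⊤ := ENNReal.pow_ne_top hfin
  calc m = m * (s ^ 2 / s ^ 2) := by rw [ENNReal.div_self h2 h2t, mul_one]
    _ ≤ m * (ENNReal.ofReal (L ^ 3) * m / s ^ 2) := by gcongr
    _ = ENNReal.ofReal (L ^ 3) * m ^ 2 / s ^ 2 := by rw [← mul_div_assoc]; ring_nf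

/-- **The floor of the crux's functional**: an `L²`-normalised, bounded, Dirichlet function has
`R_L(f) ≥ 1` (slice Cauchy–Schwarz + Fubini). Hence NO admissible constant `C < 1` — the natural
strengthening `C < 1` of the crux is false whenever the witness is non-degenerate. -/
theorem one_le_cutMoment {L : ℝ} (hL : 0 ≤ L) {f : Config (n + 1) → ℝ} (hf : Measurable f)
    (hsupp : ∀ X, X ∉ boxN (n + 1) L → f X = 0) {K : ℝ} (hK : ∀ X, |f X| ≤ K)
    (hnorm : ∫⁻ X, (‖f X‖₊ : ℝ≥0∞) ^ 2 = 1) : 1 ≤ cutMoment n L f := by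
  have hslice : ∀ Y : Config n, ∫⁻ x, (‖f (Matrix.vecCons x Y)‖₊ : ℝ≥0∞) ^ 2 ≤
      ENNReal.ofReal (L ^ 3) * (∫⁻ x, (‖f (Matrix.vecCons x Y)‖₊ : ℝ≥0∞) ^ 2) ^ 2 /
        (∫⁻ x, (‖f (Matrix.vecCons x Y)‖₊ : ℝ≥0∞)) ^ 2 := by
    intro Y
    by_cases hY : Y ∈ boxN n L
    · have hsx : ∀ x, x ∉ box L → f (Matrix.vecCons x Y) = 0 := fun x hx =>
        hsupp _ fun h => hx ((vecCons_mem_boxN_iff.1 h).1)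
      refine slice_le_ratio hL (measurable_slice hf Y) hsx ?_
      exact ne_top_of_le_ne_top (ENNReal.mul_ne_top ENNReal.ofReal_ne_top (volume_box_ne_top L))
        (lintegral_nnnorm_le_of_bound (fun x => hK _) hsx)
    · have h0 : ∀ x, f (Matrix.vecCons x Y) = 0 := fun x =>
        hsupp _ fun h => hY ((vecCons_mem_boxN_iff.1 h).2)
      simp [h0]
  calc (1 : ℝ≥0∞) = ∫⁻ X, (‖f X‖₊ : ℝ≥0∞) ^ 2 := hnorm.symm
    _ = ∫⁻ Y : Config n, ∫⁻ x, (‖f (Matrix.vecCons x Y)‖₊ : ℝ≥0∞) ^ 2 :=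
        lintegral_eq_lintegral_vecCons (hf.nnnorm.coe_nnreal_ennreal.pow_const 2)
    _ ≤ cutMoment n L f := lintegral_mono hslice

/-! ### Non-degeneracy of the flat-datum normalisation `‖e^{-TH}1‖₂²` -/

/-- `‖Z_T‖₂² ≤ |Λ_L^N| < ∞` (`T ≥ 0`): `Z_T ≤ 1` and `Z_T = 0` off the box. -/
theorem fkNormSq_one_ne_top {N : ℕ} (v : ℝ → ℝ≥0∞) (L : ℝ) {T : ℝ} (hT : 0 ≤ T) :
    fkNormSq (N := N) v L T (fun _ => (1 : ℝ≥0∞)) ≠ ⊤ := by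
  refine ne_top_of_le_ne_top (volume_boxN_lt_top N L).ne ?_
  rw [fkNormSq, ← setLIntegral_one, ← lintegral_indicator (measurableSet_boxN N L)]
  refine lintegral_mono fun X => ?_
  by_cases hX : X ∈ boxN N L
  · rw [Set.indicator_of_mem hX]
    calc fkSemigroup v L T (fun _ => 1) X ^ 2 ≤ 1 ^ 2 := by
          gcongr; exact fkPartition_le_one v L T X
      _ = 1 := one_pow 2
  · rw [Set.indicator_of_notMem hX, fkSemigroup_of_notMem v hT _ hX]; simp

/-- `‖Z_T‖₂² ≠ 0` for BOUNDED measurable `v`, `L > 0`, `T > 0`: `Z_T > 0` on the open box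
(positive survival, `fkReal_one_pos`) and the box has positive volume. (For hard cores — `v = ⊤`
on an interval, admissible — non-degeneracy at low density is part of `WitnessTransfer`.) -/
theorem fkNormSq_one_ne_zero {N : ℕ} {v : ℝ → ℝ≥0∞} (hv : Measurable v) {C : ℝ≥0}
    (hC : ∀ r, v r ≤ C) {L : ℝ} (hL : 0 < L) {T : ℝ} (hT : 0 < T) :
    fkNormSq (N := N) v L T (fun _ => (1 : ℝ≥0∞)) ≠ 0 := by
  have hpos : ∀ X ∈ boxN N L, 0 < fkSemigroup v L T (fun _ => (1 : ℝ≥0∞)) X := by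
    intro X hX
    have h := fkReal_one_pos (N := N) hv hC hT hX
    rw [fkReal_eq_toReal_fkSemigroup hv L T measurable_const (fun _ => zero_le_one) X] at h
    simp only [ENNReal.ofReal_one] at h
    exact pos_iff_ne_zero.2 fun h0 => h.ne' (by rw [h0, ENNReal.toReal_zero])
  have hm : Measurable fun X : Config N => fkSemigroup v L T (fun _ => (1 : ℝ≥0∞)) X ^ 2 :=
    (measurable_fkSemigroup (N := N) hv L T measurable_const).pow_const 2
  rw [fkNormSq, ← pos_iff_ne_zero, lintegral_pos_iff_support hm]
  have hsub : boxN N L ⊆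
      Function.support fun X : Config N => fkSemigroup v L T (fun _ => (1 : ℝ≥0∞)) X ^ 2 :=
    fun X hX => by simpa [Function.mem_support] using (hpos X hX).ne'
  refine lt_of_lt_of_le ?_ (measure_mono hsub)
  rw [volume_boxN]
  exact ENNReal.pow_pos (ENNReal.pow_pos (ENNReal.ofReal_pos.2 hL) 3) N

/-- **The crux's integral is at least `1`** for bounded measurable `v`, `L > 0`, `T > 0`
(the flat-datum witness is then a genuine `L²`-normalised Dirichlet function). -/
theorem one_le_cutMoment_fkWitness {v : ℝ → ℝ≥0∞} (hv : Measurable v) {C : ℝ≥0}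
    (hC : ∀ r, v r ≤ C) {L : ℝ} (hL : 0 < L) {T : ℝ} (hT : 0 < T) :
    1 ≤ cutMoment n L (fkWitness (N := n + 1) v L T (fun _ => (1 : ℝ≥0∞))) := by
  set 𝒩 := fkNormSq (N := n + 1) v L T (fun _ => (1 : ℝ≥0∞)) with h𝒩
  have h0 : 𝒩 ≠ 0 := fkNormSq_one_ne_zero hv hC hL hT
  have htop : 𝒩 ≠ ⊤ := fkNormSq_one_ne_top v L hT.le
  set f := fkWitness (N := n + 1) v L T (fun _ => (1 : ℝ≥0∞)) with hf
  have hfm : Measurable f := measurable_fkWitness hv L T measurable_const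
  have hsupp : ∀ X, X ∉ boxN (n + 1) L → f X = 0 := fun X hX => fkWitness_of_notMem v hT.le _ hX
  have hK : ∀ X, |f X| ≤ (Real.sqrt 𝒩.toReal)⁻¹ := by
    intro X
    rw [abs_of_nonneg (fkWitness_nonneg v L T _ X), fkWitness_apply, div_eq_mul_inv]
    refine mul_le_of_le_one_left (inv_nonneg.2 (Real.sqrt_nonneg _)) ?_
    have := ENNReal.toReal_mono ENNReal.one_ne_top (fkPartition_le_one v L T X)
    simpa [fkPartition] using this
  have hnorm : ∫⁻ X, (‖f X‖₊ : ℝ≥0∞) ^ 2 = 1 := by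
    rw [← lintegral_fkWitness_sq hv L T measurable_const h0 htop]
    refine lintegral_congr fun X => ?_
    rw [← enorm_eq_nnnorm, Real.enorm_of_nonneg (fkWitness_nonneg v L T _ X)]
  exact one_le_cutMoment hL.le hfm hsupp hK hnorm

/-- The natural strengthening of the crux with a constant BELOW `1`
(`… ∃ C, C < 1 ∧ ∀ᶠ n, ∀ T ≥ 1, R ≤ C`). -/
def TwoReplicaTransienceBoundBelowOne : Prop :=
  ∀ v : ℝ → ℝ≥0∞, IsRepulsiveFiniteRange v → ∃ ρ₀ : ℝ, 0 < ρ₀ ∧ ∀ ρ : ℝ, 0 < ρ → ρ < ρ₀ →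
    ∃ C : ℝ, C < 1 ∧ ∀ᶠ n : ℕ in Filter.atTop, ∀ T : ℝ, 1 ≤ T →
      cutMoment n (sideLength ρ (n + 1))
        (fkWitness (N := n + 1) v (sideLength ρ (n + 1)) T (fun _ => (1 : ℝ≥0∞))) ≤ ENNReal.ofReal C

/-- `cutMoment` is literally the crux's integral (definitional unfolding check). -/
theorem twoReplicaTransienceBound_iff :
    Summit.AtomisticToContinuum.BoseEinsteinCondensation.Theses.BECCutLineWeakDisorder.TwoReplicaTransienceBound ↔
    ∀ v : ℝ → ℝ≥0∞, IsRepulsiveFiniteRange v → ∃ ρ₀ : ℝ, 0 < ρ₀ ∧ ∀ ρ : ℝ, 0 < ρ → ρ < ρ₀ →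
      ∃ C : ℝ, 0 < C ∧ ∀ᶠ n : ℕ in Filter.atTop, ∀ T : ℝ, 1 ≤ T →
        cutMoment n (sideLength ρ (n + 1))
          (fkWitness (N := n + 1) v (sideLength ρ (n + 1)) T (fun _ => (1 : ℝ≥0∞))) ≤
            ENNReal.ofReal C :=
  Iff.rfl

/-- **Refutation of the strengthening `C < 1`** (witness: the FREE gas `v = 0`, any density, any
large `n`, `T = 1`: the witness is non-degenerate and `R ≥ 1`). So the crux's constant is pinned in
`[1, ∞)`; the conjectured sharp value is the free Dirichlet gas' `sup_T R_T = (π²/8)³ ≈ 1.878`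
(attained as `T → ∞`; not formalised: needs the Dirichlet heat-kernel eigen-expansion). -/
theorem not_twoReplicaTransienceBoundBelowOne : ¬ TwoReplicaTransienceBoundBelowOne := by
  intro h
  have hv : IsRepulsiveFiniteRange (fun _ : ℝ => (0 : ℝ≥0∞)) := ⟨measurable_const, 0, fun _ _ => rfl⟩
  obtain ⟨ρ₀, hρ₀, H⟩ := h _ hv
  obtain ⟨C, hC1, hev⟩ := H (ρ₀ / 2) (by positivity) (by linarith)
  obtain ⟨n, hn⟩ := hev.exists
  have hL : 0 < sideLength (ρ₀ / 2) (n + 1) :=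
    Real.rpow_pos_of_pos (div_pos (by exact_mod_cast Nat.succ_pos n) (by positivity)) _
  have h1 := one_le_cutMoment_fkWitness (n := n) (v := fun _ => (0 : ℝ≥0∞)) measurable_const
    (C := 0) (fun _ => le_rfl) hL one_pos
  have h2 := hn 1 le_rfl
  have : (1 : ℝ≥0∞) < 1 := (h1.trans h2).trans_lt (ENNReal.ofReal_lt_one.2 hC1)
  exact lt_irrefl _ this


/-! ### Line `SketchIdeator1` (tracer decoupling): the ENGINE stub `stub_tracerSecondMoment` is false

`TracerSecondMoment` (Theorems/BECCutLineWeakDisorderDefs.lean) bounds, uniformly in `T ≥ 1`,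
`E(T) := ∫ L³ m(Y)·[Z_n(Y) ∫ w(Y,ωb) ∫ₓ tracer(x,Y,ωb)² dW_n] / s(Y)² dY ≤ C ‖Z_T‖₂²`.
By Tonelli, `∫ w(Y,ωb) tracer(x,ωb) tracer(x',ωb) dW_n(ωb) = (e^{-T H'_{n+2}} 1)(x, x', Y)` with
`H'_{n+2} = -∑Δ + ∑_{bath pairs} v + ∑ⱼ v(x−yⱼ) + ∑ⱼ v(x'−yⱼ)` — `n` bath lines plus TWO tagged
lines that both repel the bath but NOT each other (two tracer replicas in ONE shared bath history).
At FIXED `n` (finite box) Perron–Frobenius asymptotics `e^{-TH}1 ≈ e^{-E T}⟨Ψ₀,1⟩Ψ₀` give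
`E(T)/‖Z_T‖₂² ≍ exp(γₙ T)`, `γₙ := 2E_{n+1} − E_n − E'_{n+2}`, where `E_k` = Dirichlet ground
energy of `k` particles and `E'_{n+2}` that of `H'_{n+2}`. Cauchy–Schwarz in the bath FK measure
(= the line's own `stub_decoupling`, read on total masses) gives `γₙ ≥ 0`; second-order
perturbation theory in the tagged–bath coupling `λW` gives
`γₙ = 2λ² ∑_{m≠0} |⟨m, φ₀|W|0, φ₀⟩|² / (E_m − E_0) + O(λ³) > 0`
(bath-mediated ATTRACTION of the two tracer replicas: `k ↦ F(k)`, the ground energy with `k`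
mutually non-interacting tagged particles, is strictly concave), and in the dilute 3-D gas the
LHY-corrected Tan contact gives `γₙ ≈ (16/(3√π)) √(ρa³) · 8πaρ/N > 0`. Hence for every admissible
`v ≢ 0` and every `n ≥ 1`, `sup_{T ≥ 1} E(T)/‖Z_T‖₂² = ∞`: the stub's "uniformly in `T ≥ 1`" fails
box by box (the crux itself converges to the ground-state value as `T → ∞` and is unaffected).
Toy confirmation: compute job `j016489` (d = 1, n = 1, 2 exact diagonalisation; d = 3 lattice
n = 1): table in the crux evidence `stubs/stub_tracerSecondMoment.md`.
The Lean content below is the bookkeeping half: fixed-box divergence ⇒ ¬ stub. -/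

section Line

open Summit.AtomisticToContinuum.BoseEinsteinCondensation.Cruxes.TwoReplicaTransienceBound.TracerDecoupling

/-- The engine's left-hand side at `(v, L, n, T)` (textually the integrand of `TracerSecondMoment`). -/
def engineLHS (v : ℝ → ℝ≥0∞) (L : ℝ) (n : ℕ) (T : ℝ) : ℝ≥0∞ :=
  ∫⁻ Y : Config n, ENNReal.ofReal (L ^ 3) *
    ((∫⁻ x, fkPartition v L T (Matrix.vecCons x Y) ^ 2) *
      (fkPartition v L T Y *
        ∫⁻ ωb, fkWeight v L T Y ωb * (∫⁻ x, tracer v L T x Y ωb ^ 2) ∂wienerPaths n)) /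
      (∫⁻ x, fkPartition v L T (Matrix.vecCons x Y)) ^ 2

/-- `TracerSecondMoment` read through `engineLHS` (definitional). -/
theorem tracerSecondMoment_iff :
    TracerSecondMoment ↔
      ∀ v : ℝ → ℝ≥0∞, IsRepulsiveFiniteRange v → ∃ ρ₀ : ℝ, 0 < ρ₀ ∧ ∀ ρ : ℝ, 0 < ρ → ρ < ρ₀ →
        ∃ C : ℝ, 0 < C ∧ ∀ᶠ n : ℕ in Filter.atTop, ∀ T : ℝ, 1 ≤ T →
          engineLHS v (sideLength ρ (n + 1)) n T ≤
            ENNReal.ofReal C * fkNormSq (N := n + 1) v (sideLength ρ (n + 1)) T (fun _ => (1 : ℝ≥0∞)) :=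
  Iff.rfl

/-- **Fixed-box divergence of the annealed two-tracer moment** (the spectral input of the stub
kill, NOT provable in the tree today: it needs the `T → ∞` Perron–Frobenius asymptotics of the
three partition functions `Z^{(n+1)}`, `Z^{(n)}`, `e^{-TH'_{n+2}}1` — in the tree only under an
`IsGroundStateFK` hypothesis — and the strict concavity `γₙ = 2E_{n+1} − E_n − E'_{n+2} > 0`):
in every box and for every particle number `n ≥ 1`, `E(T)` outgrows `C ‖Z_T‖₂²` along `T → ∞`. -/
def FixedBoxTracerDivergence (v : ℝ → ℝ≥0∞) : Prop :=
  ∀ n : ℕ, 1 ≤ n → ∀ L : ℝ, 0 < L → ∀ C T₀ : ℝ, ∃ T : ℝ, T₀ ≤ T ∧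
    ENNReal.ofReal C * fkNormSq (N := n + 1) v L T (fun _ => (1 : ℝ≥0∞)) < engineLHS v L n T

/-- **Stub kill, bookkeeping half (kernel-checked)**: if ONE admissible `v` has the fixed-box
divergence, `stub_tracerSecondMoment` is false — the stub asks for a bound uniform in `T ≥ 1` at
each large `n`, and the divergence defeats every constant in every box. -/
theorem tracerSecondMoment_false_of_fixedBoxTracerDivergence {v : ℝ → ℝ≥0∞}
    (hv : IsRepulsiveFiniteRange v) (hdiv : FixedBoxTracerDivergence v) : ¬ TracerSecondMoment := by
  intro h
  obtain ⟨ρ₀, hρ₀, H⟩ := h v hv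
  obtain ⟨C, -, hev⟩ := H (ρ₀ / 2) (by positivity) (by linarith)
  obtain ⟨n, hn, hn1⟩ := (hev.and (eventually_ge_atTop 1)).exists
  have hL : 0 < sideLength (ρ₀ / 2) (n + 1) :=
    Real.rpow_pos_of_pos (div_pos (by exact_mod_cast Nat.succ_pos n) (by positivity)) _
  obtain ⟨T, hT, hlt⟩ := hdiv n hn1 _ hL C 1
  exact (not_lt.2 (hn T hT)) hlt

/-- The same, as a kill of the REGISTERED stub alias `Goal.stub_tracerSecondMoment`. -/
theorem stub_tracerSecondMoment_false_of_fixedBoxTracerDivergence {v : ℝ → ℝ≥0∞}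
    (hv : IsRepulsiveFiniteRange v) (hdiv : FixedBoxTracerDivergence v) :
    ¬ Goal.stub_tracerSecondMoment :=
  tracerSecondMoment_false_of_fixedBoxTracerDivergence hv hdiv

end Line

/-! ### Near-misses (sorried; the obstruction is in the docstring) -/

section NearMisses

/-- NEAR-MISS (physics-level certain, not formalisable today): the soft sphere
`v = 𝟙_{[0,1]}` (admissible, bounded) has the fixed-box divergence. Obstruction: (i) no `T → ∞`
asymptotics `Z_T(X) e^{E T} → ⟨Ψ₀,1⟩Ψ₀(X)` for `fkPartition` without an `IsGroundStateFK` instance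
(existence of the FK ground state of `H_{n+1}`, `H_n` AND of the two-tracer `H'_{n+2}`, which is not
of the `interaction v` form — its pair set omits one pair); (ii) strictness `γₙ > 0` needs
second-order perturbation theory / a variational separation of ground energies, absent from
Mathlib. With (i)+(ii), `E(T)/‖Z_T‖² → ∞` exponentially and the statement follows. -/
theorem fixedBoxTracerDivergence_softSphere :
    FixedBoxTracerDivergence (Set.indicator (Set.Icc (0 : ℝ) 1) fun _ => (1 : ℝ≥0∞)) := by
  sorry

end NearMisses

end Summit.AtomisticToContinuum.BoseEinsteinCondensation.Cruxes.TwoReplicaTransienceBound.Disproof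

end
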